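import Literature.Analysis.FluidPDE.LocalTypeILscGradientTools
import Literature.Analysis.FluidPDE.ConstantinDirectionDissipationCalculus
import HarnessLib

/-!
# Depth vorticity rigidity, part 3: the weak curl passes to `L³_loc` limits, and «weak curl zero on
# a box at depth ⇒ the origin is not backward-singular» — helper for item
# `TerminalTrace.TypeITraceScarL3` (stmt-NavierStokesRegularity-18385), stub QA of line `annulus-dichotomy`

Seat nsreg-C26-p1 (prover), `--supports stmt-NavierStokesRegularity-18385`; planner of record nsreg-p2
g28, ROUND-26 §1c (Q1), compactness half.

* `weakAntisym_ae_zero_of_tendsto` — if `v_k → u` in `L³(Q₀)`, `G_k`, `H` are weak spatial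
  gradients of `v_k`, `u` on an open `O ⊆ Q₀`, and the antisymmetric entries
  `⟪G_k a, c⟫ − ⟪G_k c, a⟫` tend to `0` in `L¹(O)`, then `⟪H a, c⟫ − ⟪H c, a⟫ = 0` a.e. on `O`
  (the weak-gradient identity `∫_O ψ ⟪G a, c⟫ = −∫ ∂_aψ ⟪v, c⟫`, convergence of the pairings
  `tendsto_integral_mul_inner_of_tendsto_eLpNorm`, and the fundamental lemma of the calculus of
  variations `IsOpen.ae_eq_zero_of_integral_contDiff_smul_eq_zero`).
* `weakCurl_ae_zero_of_tendsto` — the same for the curl vector `curlCLM ∘ G_k → 0` in `L¹(O)`: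
  then `curlCLM ∘ H = 0` a.e. on `O` (coordinates of the curl are antisymmetric entries,
  `curlCLM_apply_coord`).

WHAT THIS IS NOT: not Stub QA, not item 18385, no statement about Navier–Stokes regularity.
[folklore; AlbrittonBarker2019 §3 (lower semicontinuity step); Evans2010 §5.2.1]
-/

noncomputable section

set_option linter.dupNamespace false

namespace Summit.NavierStokesRegularity.NavierStokesRegularity.Theorems.TypeITraceScarL3

open MeasureTheory Set Function Filter Topology TopologicalSpace Metric InnerProductSpace
open Literature.Analysis Literature.Analysis.FluidPDE
open scoped NNReal ENNReal RealInnerProductSpace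

/-! ### Antisymmetric entries of weak gradients pass to `L³_loc` limits -/

/-- **Weak limits of antisymmetric gradient entries.**  Let `O ⊆ Q₀` be open in `ℝ × ℝ³`, let
`G_k`, `H` be weak spatial gradients of `v_k`, `u` on `O`, let `v_k → u` in `L³(Q₀)`, and suppose
`∫_O |⟪G_k a, c⟫ − ⟪G_k c, a⟫| → 0`.  Then `⟪H a, c⟫ − ⟪H c, a⟫ = 0` a.e. on `O`: for a test function
`ψ ∈ C_c^∞(O)`, `∫_O ψ (⟪G_k a, c⟫ − ⟪G_k c, a⟫) = −∫ (∂_aψ ⟪v_k, c⟫ − ∂_cψ ⟪v_k, a⟫)` converges both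
to `0` and to the same expression for `(u, H)`; conclude by the fundamental lemma of the calculus of
variations. [folklore; Evans2010 §5.2.1] -/
theorem weakAntisym_ae_zero_of_tendsto
    {O Q₀ : Set (ℝ × EuclideanSpace ℝ (Fin 3))} (hO : IsOpen O) (hOQ : O ⊆ Q₀)
    {v : ℕ → ℝ → EuclideanSpace ℝ (Fin 3) → EuclideanSpace ℝ (Fin 3)}
    {G : ℕ → ℝ → EuclideanSpace ℝ (Fin 3) → EuclideanSpace ℝ (Fin 3) →L[ℝ] EuclideanSpace ℝ (Fin 3)}
    {u : ℝ → EuclideanSpace ℝ (Fin 3) → EuclideanSpace ℝ (Fin 3)}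
    {H : ℝ → EuclideanSpace ℝ (Fin 3) → EuclideanSpace ℝ (Fin 3) →L[ℝ] EuclideanSpace ℝ (Fin 3)}
    (hG : ∀ k, HasWeakSpatialGradientOn ⟨O, hO⟩ (v k) (G k))
    (hH : HasWeakSpatialGradientOn ⟨O, hO⟩ u H)
    (hconv : Tendsto (fun k => eLpNorm (uncurry (v k) - uncurry u) 3 (volume.restrict Q₀))
      atTop (𝓝 0))
    (a c : EuclideanSpace ℝ (Fin 3))
    (hsmall : Tendsto (fun k => ∫⁻ z in O, ‖⟪G k z.1 z.2 a, c⟫ - ⟪G k z.1 z.2 c, a⟫‖ₑ) atTop (𝓝 0)) :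
    ∀ᵐ z ∂(volume.restrict O), ⟪H z.1 z.2 a, c⟫ - ⟪H z.1 z.2 c, a⟫ = 0 := by
  set Ω : Opens (ℝ × EuclideanSpace ℝ (Fin 3)) := ⟨O, hO⟩ with hΩdef
  have hΩO : (Ω : Set (ℝ × EuclideanSpace ℝ (Fin 3))) = O := rfl
  set f : ℝ × EuclideanSpace ℝ (Fin 3) → ℝ := fun z => ⟪H z.1 z.2 a, c⟫ - ⟪H z.1 z.2 c, a⟫ with hfdef
  set fk : ℕ → ℝ × EuclideanSpace ℝ (Fin 3) → ℝ :=
    fun k z => ⟪G k z.1 z.2 a, c⟫ - ⟪G k z.1 z.2 c, a⟫ with hfkdef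
  have hfloc : LocallyIntegrableOn f O volume :=
    (locallyIntegrableOn_inner_apply hH.locallyIntegrableOn_grad a c).sub
      (locallyIntegrableOn_inner_apply hH.locallyIntegrableOn_grad c a)
  have hfkloc : ∀ k, LocallyIntegrableOn (fk k) O volume := fun k =>
    (locallyIntegrableOn_inner_apply (hG k).locallyIntegrableOn_grad a c).sub
      (locallyIntegrableOn_inner_apply (hG k).locallyIntegrableOn_grad c a)
  -- ### the fundamental lemma of the calculus of variations on `O`
  suffices hzero : ∀ g : ℝ × EuclideanSpace ℝ (Fin 3) → ℝ, ContDiff ℝ (⊤ : ℕ∞) g →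
      HasCompactSupport g → tsupport g ⊆ O → ∫ z, g z • f z = 0 by
    have h := hO.ae_eq_zero_of_integral_contDiff_smul_eq_zero hfloc hzero
    rw [ae_restrict_iff' hO.measurableSet]
    exact h
  intro g hg hgc hgO
  -- the test function in curried form and its derivative weights
  set ψ : ℝ → EuclideanSpace ℝ (Fin 3) → ℝ := fun t x => g (t, x) with hψdef
  have hψg : uncurry ψ = g := by funext z; rfl
  have hψ : IsSpaceTimeTestOn Ω ψ := ⟨by rw [hψg]; exact hg, by rw [hψg]; exact hgc, by rw [hψg]; exact hgO⟩
  set K : Set (ℝ × EuclideanSpace ℝ (Fin 3)) := tsupport g with hKdef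
  have hK : IsCompact K := hgc
  have hKO : K ⊆ O := hgO
  have hg0 : ∀ z ∉ K, g z = 0 := fun z hz => image_eq_zero_of_notMem_tsupport hz
  set θ : EuclideanSpace ℝ (Fin 3) → ℝ × EuclideanSpace ℝ (Fin 3) → ℝ :=
    fun e z => fderiv ℝ (ψ z.1) z.2 e with hθdef
  have hθtest : ∀ e, IsSpaceTimeTestOn (⊤ : Opens (ℝ × EuclideanSpace ℝ (Fin 3)))
      (fun t x => fderiv ℝ (ψ t) x e) := fun e => (hψ.mono le_top).fderiv_apply_top e
  have hθc : ∀ e, Continuous (θ e) := fun e => (hθtest e).contDiff.continuous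
  have hθ0 : ∀ e, ∀ z ∉ K, θ e z = 0 := by
    rintro e ⟨t, x⟩ hz
    have hz' : (t, x) ∉ tsupport (uncurry ψ) := by rwa [hψg]
    simp [hθdef, IsSpaceTimeTestOn.fderiv_slice_eq_zero_of_notMem hz']
  have hθsupp : ∀ e, tsupport (θ e) ⊆ O := fun e =>
    (tsupport_subset_of_isClosed (isClosed_tsupport g) (hθ0 e)).trans hKO
  have hθcs : ∀ e, HasCompactSupport (θ e) := fun e =>
    HasCompactSupport.intro hK (hθ0 e)
  -- ### the pairings, for the limit and along the sequence
  -- `R w := -(∫ θ_a ⟪w, c⟫ - ∫ θ_c ⟪w, a⟫)`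
  have hpair : ∀ {w : ℝ → EuclideanSpace ℝ (Fin 3) → EuclideanSpace ℝ (Fin 3)}
      {Gw : ℝ → EuclideanSpace ℝ (Fin 3) → EuclideanSpace ℝ (Fin 3) →L[ℝ] EuclideanSpace ℝ (Fin 3)},
      HasWeakSpatialGradientOn Ω w Gw →
      ∫ z in O, ψ z.1 z.2 * (⟪Gw z.1 z.2 a, c⟫ - ⟪Gw z.1 z.2 c, a⟫) =
        -((∫ z, θ a z * ⟪w z.1 z.2, c⟫) - ∫ z, θ c z * ⟪w z.1 z.2, a⟫) := by
    intro w Gw hw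
    have h1 := setIntegral_mul_inner_weakGradient_eq hw hψ a c
    have h2 := setIntegral_mul_inner_weakGradient_eq hw hψ c a
    rw [hΩO] at h1 h2
    have hi1 : Integrable (fun z : ℝ × EuclideanSpace ℝ (Fin 3) => ⟪Gw z.1 z.2 a, c⟫ * uncurry ψ z)
        (volume.restrict O) :=
      (integrable_mul_of_locallyIntegrableOn (Q := Ω)
        (locallyIntegrableOn_inner_apply hw.locallyIntegrableOn_grad a c)
        hψ.contDiff.continuous hK hKO (fun z hz => by rw [hψg]; exact hg0 z hz)).restrict
    have hi2 : Integrable (fun z : ℝ × EuclideanSpace ℝ (Fin 3) => ⟪Gw z.1 z.2 c, a⟫ * uncurry ψ z)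
        (volume.restrict O) :=
      (integrable_mul_of_locallyIntegrableOn (Q := Ω)
        (locallyIntegrableOn_inner_apply hw.locallyIntegrableOn_grad c a)
        hψ.contDiff.continuous hK hKO (fun z hz => by rw [hψg]; exact hg0 z hz)).restrict
    have e : (fun z : ℝ × EuclideanSpace ℝ (Fin 3) =>
        ψ z.1 z.2 * (⟪Gw z.1 z.2 a, c⟫ - ⟪Gw z.1 z.2 c, a⟫)) =
        fun z => ⟪Gw z.1 z.2 a, c⟫ * uncurry ψ z - ⟪Gw z.1 z.2 c, a⟫ * uncurry ψ z := by
      funext z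
      simp only [uncurry]
      ring
    rw [e, integral_sub hi1 hi2]
    have e1 : ∫ z in O, ⟪Gw z.1 z.2 a, c⟫ * uncurry ψ z = ∫ z in O, ψ z.1 z.2 * ⟪Gw z.1 z.2 a, c⟫ :=
      integral_congr_ae (ae_of_all _ fun z => by simp only [uncurry]; ring)
    have e2 : ∫ z in O, ⟪Gw z.1 z.2 c, a⟫ * uncurry ψ z = ∫ z in O, ψ z.1 z.2 * ⟪Gw z.1 z.2 c, a⟫ :=
      integral_congr_ae (ae_of_all _ fun z => by simp only [uncurry]; ring)
    rw [e1, e2, h1, h2]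
    ring
  -- ### convergence of the right-hand sides
  have hvloc : ∀ k, LocallyIntegrableOn (uncurry (v k)) (Ω : Set (ℝ × EuclideanSpace ℝ (Fin 3)))
      volume := fun k => (hG k).locallyIntegrableOn
  have huloc : LocallyIntegrableOn (uncurry u) (Ω : Set (ℝ × EuclideanSpace ℝ (Fin 3))) volume :=
    hH.locallyIntegrableOn
  have hRlim : Tendsto (fun k => -((∫ z, θ a z * ⟪v k z.1 z.2, c⟫) - ∫ z, θ c z * ⟪v k z.1 z.2, a⟫))
      atTop (𝓝 (-((∫ z, θ a z * ⟪u z.1 z.2, c⟫) - ∫ z, θ c z * ⟪u z.1 z.2, a⟫))) := by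
    have h1 := tendsto_integral_mul_inner_of_tendsto_eLpNorm (Ω := Ω) hOQ hvloc huloc hconv
      (hθc a) (hθcs a) (hθsupp a) c
    have h2 := tendsto_integral_mul_inner_of_tendsto_eLpNorm (Ω := Ω) hOQ hvloc huloc hconv
      (hθc c) (hθcs c) (hθsupp c) a
    exact (h1.sub h2).neg
  -- ### the left-hand sides tend to zero
  obtain ⟨C, hC⟩ := hψ.contDiff.continuous.bounded_above_of_compact_support (by rw [hψg]; exact hgc)
  have hC0 : 0 ≤ C := (norm_nonneg _).trans (hC 0)
  have hLlim : Tendsto (fun k => ∫ z in O, ψ z.1 z.2 * fk k z) atTop (𝓝 0) := by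
    have htoReal : Tendsto (fun k => (ENNReal.ofReal C * ∫⁻ z in O, ‖fk k z‖ₑ).toReal)
        atTop (𝓝 0) := by
      have h1 : Tendsto (fun k => ENNReal.ofReal C * ∫⁻ z in O, ‖fk k z‖ₑ) atTop (𝓝 0) := by
        have h := ENNReal.Tendsto.const_mul hsmall (Or.inr ENNReal.ofReal_ne_top) (a := ENNReal.ofReal C)
        rwa [mul_zero] at h
      have h2 := (ENNReal.tendsto_toReal ENNReal.zero_ne_top).comp h1
      rwa [ENNReal.toReal_zero] at h2
    refine squeeze_zero_norm' ?_ htoReal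
    have hev : ∀ᶠ k in atTop, ∫⁻ z in O, ‖fk k z‖ₑ < 1 :=
      (tendsto_order.1 hsmall).2 1 zero_lt_one
    filter_upwards [hev] with k hk
    have hfin : ENNReal.ofReal C * ∫⁻ z in O, ‖fk k z‖ₑ ≠ ⊤ :=
      ENNReal.mul_ne_top ENNReal.ofReal_ne_top (hk.trans ENNReal.one_lt_top).ne
    have hbound : ‖∫ z in O, ψ z.1 z.2 * fk k z‖ₑ ≤ ENNReal.ofReal C * ∫⁻ z in O, ‖fk k z‖ₑ := by
      refine (enorm_integral_le_lintegral_enorm _).trans ?_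
      rw [← lintegral_const_mul' _ _ ENNReal.ofReal_ne_top]
      refine lintegral_mono fun z => ?_
      rw [enorm_mul, ← ofReal_norm (ψ z.1 z.2)]
      gcongr
      exact hC (z.1, z.2)
    calc ‖∫ z in O, ψ z.1 z.2 * fk k z‖ = (‖∫ z in O, ψ z.1 z.2 * fk k z‖ₑ).toReal := by
          rw [toReal_enorm]
      _ ≤ (ENNReal.ofReal C * ∫⁻ z in O, ‖fk k z‖ₑ).toReal := ENNReal.toReal_mono hfin hbound
  -- ### conclusion
  have hLeq : ∀ k, ∫ z in O, ψ z.1 z.2 * fk k z =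
      -((∫ z, θ a z * ⟪v k z.1 z.2, c⟫) - ∫ z, θ c z * ⟪v k z.1 z.2, a⟫) := fun k => hpair (hG k)
  have hlim0 : -((∫ z, θ a z * ⟪u z.1 z.2, c⟫) - ∫ z, θ c z * ⟪u z.1 z.2, a⟫) = 0 :=
    tendsto_nhds_unique hRlim (by simpa only [hLeq] using hLlim)
  have hgf : ∫ z, g z • f z = ∫ z in O, ψ z.1 z.2 * f z := by
    have h0 : ∀ z ∉ O, ψ z.1 z.2 * f z = 0 := fun z hz => by
      rw [show ψ z.1 z.2 = g z from rfl, hg0 z fun h => hz (hKO h), zero_mul]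
    rw [setIntegral_eq_integral_of_forall_compl_eq_zero h0]
    simp only [smul_eq_mul]
    rfl
  rw [hgf, hpair hH, hlim0]

/-! ### The weak curl passes to `L³_loc` limits -/

/-- **Weak limits of the curl part of weak gradients.**  In the setting of
`weakAntisym_ae_zero_of_tendsto`, if `∫_O |curlCLM (G_k)| → 0` then `curlCLM ∘ H = 0` a.e. on `O`
(each coordinate of the curl vector is an antisymmetric entry, `curlCLM_apply_coord`, bounded by the
norm of the curl vector). [folklore; Evans2010 §5.2.1] -/
theorem weakCurl_ae_zero_of_tendsto
    {O Q₀ : Set (ℝ × EuclideanSpace ℝ (Fin 3))} (hO : IsOpen O) (hOQ : O ⊆ Q₀)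
    {v : ℕ → ℝ → EuclideanSpace ℝ (Fin 3) → EuclideanSpace ℝ (Fin 3)}
    {G : ℕ → ℝ → EuclideanSpace ℝ (Fin 3) → EuclideanSpace ℝ (Fin 3) →L[ℝ] EuclideanSpace ℝ (Fin 3)}
    {u : ℝ → EuclideanSpace ℝ (Fin 3) → EuclideanSpace ℝ (Fin 3)}
    {H : ℝ → EuclideanSpace ℝ (Fin 3) → EuclideanSpace ℝ (Fin 3) →L[ℝ] EuclideanSpace ℝ (Fin 3)}
    (hG : ∀ k, HasWeakSpatialGradientOn ⟨O, hO⟩ (v k) (G k))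
    (hH : HasWeakSpatialGradientOn ⟨O, hO⟩ u H)
    (hconv : Tendsto (fun k => eLpNorm (uncurry (v k) - uncurry u) 3 (volume.restrict Q₀))
      atTop (𝓝 0))
    (hsmall : Tendsto (fun k => ∫⁻ z in O, ‖curlCLM (G k z.1 z.2)‖ₑ) atTop (𝓝 0)) :
    ∀ᵐ z ∂(volume.restrict O), curlCLM (H z.1 z.2) = 0 := by
  set b : OrthonormalBasis (Fin 3) ℝ (EuclideanSpace ℝ (Fin 3)) := EuclideanSpace.basisFun (Fin 3) ℝ
    with hb
  -- coordinates as inner products with the standard basis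
  have hcoord : ∀ (x : EuclideanSpace ℝ (Fin 3)) (k : Fin 3), x k = ⟪x, b k⟫ := fun x k => by
    rw [real_inner_comm, hb, EuclideanSpace.basisFun_inner]
  -- the coordinates of the curl as antisymmetric entries
  have hc : ∀ (L : EuclideanSpace ℝ (Fin 3) →L[ℝ] EuclideanSpace ℝ (Fin 3)),
      curlCLM L 0 = ⟪L (b 1), b 2⟫ - ⟪L (b 2), b 1⟫ ∧
      curlCLM L 1 = ⟪L (b 2), b 0⟫ - ⟪L (b 0), b 2⟫ ∧
      curlCLM L 2 = ⟪L (b 0), b 1⟫ - ⟪L (b 1), b 0⟫ := fun L => by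
    obtain ⟨h0, h1, h2⟩ := curlCLM_apply_coord L
    exact ⟨by rw [h0, hcoord, hcoord], by rw [h1, hcoord, hcoord], by rw [h2, hcoord, hcoord]⟩
  -- smallness of each antisymmetric entry
  have hsm : ∀ (i j : Fin 3), (∀ L : EuclideanSpace ℝ (Fin 3) →L[ℝ] EuclideanSpace ℝ (Fin 3),
      ∃ m : Fin 3, curlCLM L m = ⟪L (b i), b j⟫ - ⟪L (b j), b i⟫) →
      Tendsto (fun k => ∫⁻ z in O, ‖⟪G k z.1 z.2 (b i), b j⟫ - ⟪G k z.1 z.2 (b j), b i⟫‖ₑ)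
        atTop (𝓝 0) := by
    intro i j hij
    refine tendsto_of_tendsto_of_tendsto_of_le_of_le tendsto_const_nhds hsmall
      (fun k => bot_le) (fun k => lintegral_mono fun z => ?_)
    obtain ⟨m, hm⟩ := hij (G k z.1 z.2)
    have h1 : |⟪G k z.1 z.2 (b i), b j⟫ - ⟪G k z.1 z.2 (b j), b i⟫| ≤ ‖curlCLM (G k z.1 z.2)‖ := by
      rw [← hm]
      have h := PiLp.norm_apply_le (curlCLM (G k z.1 z.2)) m
      rwa [Real.norm_eq_abs] at h
    rw [Real.enorm_eq_ofReal_abs, ← ofReal_norm]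
    exact ENNReal.ofReal_le_ofReal h1
  have h12 := weakAntisym_ae_zero_of_tendsto hO hOQ hG hH hconv (b 1) (b 2)
    (hsm 1 2 fun L => ⟨0, (hc L).1⟩)
  have h20 := weakAntisym_ae_zero_of_tendsto hO hOQ hG hH hconv (b 2) (b 0)
    (hsm 2 0 fun L => ⟨1, (hc L).2.1⟩)
  have h01 := weakAntisym_ae_zero_of_tendsto hO hOQ hG hH hconv (b 0) (b 1)
    (hsm 0 1 fun L => ⟨2, (hc L).2.2⟩)
  filter_upwards [h12, h20, h01] with z hz0 hz1 hz2
  ext m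
  fin_cases m
  · show curlCLM (H z.1 z.2) 0 = 0
    rw [(hc _).1, hz0]
  · show curlCLM (H z.1 z.2) 1 = 0
    rw [(hc _).2.1, hz1]
  · show curlCLM (H z.1 z.2) 2 = 0
    rw [(hc _).2.2, hz2]

end Summit.NavierStokesRegularity.NavierStokesRegularity.Theorems.TypeITraceScarL3

end
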